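import Literature.Topology.FourManifolds.SphereTubeInInterior
import Literature.Topology.FourManifolds.SphereNormalFraming
import Literature.Topology.FourManifolds.HomotopySpheresSignatureProofs
import Literature.Topology.FourManifolds.ParallelizablePullback
import Literature.Topology.FourManifolds.InteriorTangent
import Literature.Topology.FourManifolds.InteriorDiscs
import Literature.Topology.FourManifolds.CollarPushIn
import Literature.Topology.FourManifolds.CollarTheorem
import Literature.Topology.FourManifolds.SphereSurgeryHomology
import HarnessLib

/-!
# Framed spheres in an s-parallelizable null-cobordism (Kervaire–Milnor, Lemma 5.3: the glue)

Topic `Literature/Topology/FourManifolds` (fact seat of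
`Literature.Topology.FourManifolds.HomotopySphere.boundsContractible_of_nullCobordism_isStablyParallelizable_four`,
Kervaire–Milnor's Thm. 5.1 at `k = 2`).  M. Kervaire, J. Milnor, *Groups of homotopy spheres I*,
Ann. of Math. 77 (1963), Lemma 5.3 (p. 513) and p. 514 l. 1–2: *"it follows from a well known
theorem of Whitney that `λ` can be represented by an imbedding `φ₀ : Sᵖ → M`.  It follows from
Lemma 3.5 that the normal bundle of `φ₀Sᵖ` in `M` is trivial.  Hence `φ₀` can be extended to the
required imbedding `Sᵖ × Dⁿ⁻ᵖ → M`"* — here for a compact CONNECTED s-parallelizable null-cobordism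
`W` (`M = ∂W ≠ ∅`) of dimension `k + p`, `k < p`, everything after Whitney's theorem is ASSEMBLED
from theorems of the tree:

* `NullCobordism.isParallelizable_interior` — the interior `W♭` of a connected s-parallelizable
  null-cobordism is parallelizable: Kervaire–Milnor's Lemma 3.4
  (`NullCobordism.isParallelizable_of_isStablyParallelizable`, `HomotopySpheresSignatureProofs`)
  pulled back along the inclusion `W♭ → W`, whose differential is the identity
  (`InteriorManifold.mfderiv_val`, `IsParallelizable.of_hasTangentFramingAlong_of_isInvertible_mfderiv`).
* `NullCobordism.exists_framedSphereFamily_of_interior_immersion` — **an injectively immersed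
  `k`-sphere in the interior of `W` is the core of a framed sphere family**
  `Sᵏ × ℝᵖ ↪ W` (`FramedSphereFamily (𝓡∂ _) W Unit k p`, the datum of `NullCobordism.surgery`):
  a frame of `TW♭` along the sphere (`exists_frame_along_of_isParallelizable`), smoothed
  (`exists_isSmoothAlong_of_continuousOn_frameIn`), Kervaire–Milnor's Lemma 3.5 / Kosinski's
  normal framing (`exists_isSmoothAlong_normal_of_frame`, needs `k < p`), and the framed tube in
  the interior pushed into `W` (`exists_framedSphereFamily_halfSpace_of_isSmoothAlong`).
* `NullCobordism.exists_homotopic_val_comp` — every map `Y → W` (`Y` arbitrary) is homotopic to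
  a map through the interior (collar push-in `BoundaryData.Collar.exists_homotopic_forall_mem_interior`
  with the collar of `BoundaryData.nonempty_collar_of_compactSpace`).
* `NullCobordism.exists_framedSphereFamily_sphereMap_homotopic_of_whitney` — hence, GIVEN
  Whitney's embedding theorem in a homotopy class for maps `Sᵏ → W♭` (plain hypothesis `hE`:
  every continuous `g : Sᵏ → W♭` is homotopic to a `C^∞` injective immersion), every map
  `f : Sᵏ → W` is homotopic to the core `ν.sphereMap` of a framed sphere family `ν`.

Everything is proved; no definitions, no named facts.  (The remaining inputs of Lemmas 5.3–5.4 —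
Whitney's theorem itself and the choice of the framing making `χ(W, φ)` s-parallelizable — stay
hypotheses of the consumers.)

## References

* M. Kervaire, J. Milnor, *Groups of homotopy spheres I*, Ann. of Math. 77 (1963), Lemmas 3.4,
  3.5 (p. 509), Lemma 5.3 (p. 513), p. 514. doi:10.2307/1970128 [KervaireMilnorAnnals1963]
* A. Kosinski, *Differential Manifolds* (1993), Ch. X §2, Lemma (2.1), p. 200; Ch. III Cor. (2.3).
  [Kosinski1993]
-/

noncomputable section

open scoped Manifold ContDiff Topology
open Set Function Bundle Module

namespace Literature.Topology.FourManifolds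

namespace NullCobordism

variable {n : ℕ} {M : Type} [TopologicalSpace M] [ChartedSpace (EuclideanSpace ℝ (Fin (n + 1))) M]
  [IsManifold (𝓡 (n + 1)) ∞ M]

/-! ### The interior of a connected s-parallelizable null-cobordism is parallelizable -/

/-- **The interior of a connected s-parallelizable null-cobordism of a non-empty closed manifold
is parallelizable** (Kervaire–Milnor 1963, Lemma 3.4, restricted to the interior along the
inclusion `W♭ → W`, an equidimensional immersion). [cite: KervaireMilnorAnnals1963, Lemma 3.4 (p. 509)] -/
theorem isParallelizable_interior [Nonempty M] [CompactSpace M] (c : NullCobordism (n + 1) M)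
    [ConnectedSpace c.W] (h : IsStablyParallelizable (𝓡∂ (n + 1 + 1)) c.W) :
    IsParallelizable 𝓘(ℝ, EuclideanSpace ℝ (Fin (n + 1 + 1)))
      (InteriorManifold (𝓡∂ (n + 1 + 1)) c.W) := by
  have hW := c.isParallelizable_of_isStablyParallelizable h
  refine IsParallelizable.of_hasTangentFramingAlong_of_isInvertible_mfderiv
    (φ := (InteriorManifold.val : InteriorManifold (𝓡∂ (n + 1 + 1)) c.W → c.W))
    (InteriorManifold.contMDiff_val.of_le (by exact_mod_cast le_top)) (fun x => ?_) ?_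
  · refine ⟨ContinuousLinearEquiv.refl ℝ (EuclideanSpace ℝ (Fin (n + 1 + 1))), ?_⟩
    rw [InteriorManifold.mfderiv_val]
    rfl
  · exact hW.comp ⟨InteriorManifold.val, InteriorManifold.continuous_val⟩

/-! ### Framed tubes around immersed spheres in the interior -/

/-- **An injectively immersed `k`-sphere in the interior of a connected s-parallelizable
null-cobordism `W` of dimension `k + p`, `k < p`, is the core of a framed sphere family
`Sᵏ × ℝᵖ ↪ W`** (Kervaire–Milnor 1963, Lemma 5.3 after Whitney's theorem: "It follows from Lemma
3.5 that the normal bundle of `φ₀Sᵖ` in `M` is trivial. Hence `φ₀` can be extended to the required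
imbedding"; Kosinski 1993, X.(2.1)): a frame of `TW♭` along the sphere from the parallelisation of
the interior, smoothed, completed to a normal framing, and thickened to a tube.
[cite: KervaireMilnorAnnals1963, Lemma 5.3 (p. 513) and p. 514] -/
theorem exists_framedSphereFamily_of_interior_immersion [Nonempty M] [CompactSpace M] {k p : ℕ}
    (hdim : n + 1 + 1 = k + p) (hkp : k < p) (c : NullCobordism (n + 1) M) [ConnectedSpace c.W]
    (h : IsStablyParallelizable (𝓡∂ (n + 1 + 1)) c.W)
    {e : Metric.sphere (0 : EuclideanSpace ℝ (Fin (k + 1))) 1 → InteriorManifold (𝓡∂ (n + 1 + 1)) c.W}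
    (he : ContMDiff (𝓡 k) 𝓘(ℝ, EuclideanSpace ℝ (Fin (n + 1 + 1))) ∞ e)
    (himm : ∀ u, Injective (mfderiv (𝓡 k) 𝓘(ℝ, EuclideanSpace ℝ (Fin (n + 1 + 1))) e u))
    (hinj : Injective e) :
    ∃ ν : FramedSphereFamily (𝓡∂ (n + 1 + 1)) c.W Unit k p, ∀ u, ν.toFun () (u, 0) = (e u).val := by
  -- a frame of `TW♭` along `e`, continuous into the tangent bundle
  obtain ⟨T, hTc, hTb⟩ :=
    exists_frame_along_of_isParallelizable (c.isParallelizable_interior h) he.continuous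
  -- smoothed
  obtain ⟨T', hT's, hT'i⟩ := exists_isSmoothAlong_of_continuousOn_frameIn (IM := 𝓡 k) he
    (fun q => continuousOn_frameIn_of_continuous_totalSpaceMk hTc q) (fun u => (hTb u).1)
  have hT'b : ∀ u, Bijective (T' u) := fun u =>
    ⟨hT'i u, LinearMap.surjective_of_injective (f := (T' u).toLinearMap) (hT'i u)⟩
  -- the normal framing (Lemma 3.5: `k < p`)
  have hfin : finrank ℝ (EuclideanSpace ℝ (Fin (n + 1 + 1))) = k + p := by simp [hdim]
  obtain ⟨N, hN, hbij⟩ := exists_isSmoothAlong_normal_of_frame hfin hkp he himm hT's hT'b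
  -- the tube
  exact exists_framedSphereFamily_halfSpace_of_isSmoothAlong he hinj hN hbij

/-! ### Pushing maps into the interior -/

/-- **Every map into a null-cobordism is homotopic to a map through the interior** (push along
a collar of `∂W`). [cite: Kosinski1993, Ch. X §2, Thm. (2.2) (proof)] -/
theorem exists_homotopic_val_comp [CompactSpace M] (c : NullCobordism (n + 1) M) {Y : Type*}
    [TopologicalSpace Y] (f : C(Y, c.W)) :
    ∃ g : C(Y, InteriorManifold (𝓡∂ (n + 1 + 1)) c.W),
      f.Homotopic ((⟨InteriorManifold.val, InteriorManifold.continuous_val⟩ : C(_, c.W)).comp g) := by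
  haveI : CompactSpace c.boundaryData.carrier := inferInstanceAs (CompactSpace M)
  obtain ⟨κ⟩ := BoundaryData.nonempty_collar_of_compactSpace n c.W c.boundaryData
  obtain ⟨g, hfg, hg⟩ := κ.exists_homotopic_forall_mem_interior f
  refine ⟨⟨InteriorManifold.lift g hg, InteriorManifold.continuous_iff_comp_val.2 g.continuous⟩, ?_⟩
  have hcomp : (⟨InteriorManifold.val, InteriorManifold.continuous_val⟩ : C(_, c.W)).comp
      ⟨InteriorManifold.lift g hg, InteriorManifold.continuous_iff_comp_val.2 g.continuous⟩ = g := by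
    ext y
    rfl
  rw [hcomp]
  exact hfg

/-! ### Lemma 5.3 over Whitney's theorem -/

/-- **Kervaire–Milnor's Lemma 5.3 over Whitney's embedding theorem.**  Let `W` be a compact
connected s-parallelizable null-cobordism of dimension `k + l + 1`, `k ≤ l`, and suppose (`hE`,
Whitney 1936 / Hirsch 1976 Thm. 2.2.13 for the non-compact interior `W♭`: "since `n ≥ 2p + 1` …
`λ` can be represented by an imbedding") that every continuous `g : Sᵏ → W♭` is homotopic to a
`C^∞` injective immersion.  Then every map `f : Sᵏ → W` is homotopic to the core of a framed
sphere family `ν : Sᵏ × ℝˡ⁺¹ ↪ W`. [cite: KervaireMilnorAnnals1963, Lemma 5.3 (p. 513) and p. 514] -/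
theorem exists_framedSphereFamily_sphereMap_homotopic_of_whitney [Nonempty M] [CompactSpace M]
    {k l : ℕ} (hdim : n + 1 + 1 = k + (l + 1)) (hkl : k < l + 1) (c : NullCobordism (n + 1) M)
    [ConnectedSpace c.W] (h : IsStablyParallelizable (𝓡∂ (n + 1 + 1)) c.W)
    (hE : ∀ g : C(Metric.sphere (0 : EuclideanSpace ℝ (Fin (k + 1))) 1,
        InteriorManifold (𝓡∂ (n + 1 + 1)) c.W),
      ∃ e : Metric.sphere (0 : EuclideanSpace ℝ (Fin (k + 1))) 1 → InteriorManifold (𝓡∂ (n + 1 + 1)) c.W,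
        ContMDiff (𝓡 k) 𝓘(ℝ, EuclideanSpace ℝ (Fin (n + 1 + 1))) ∞ e ∧
        (∀ u, Injective (mfderiv (𝓡 k) 𝓘(ℝ, EuclideanSpace ℝ (Fin (n + 1 + 1))) e u)) ∧
        Injective e ∧ ∃ he : Continuous e, (⟨e, he⟩ : C(_, _)).Homotopic g)
    (f : C(Metric.sphere (0 : EuclideanSpace ℝ (Fin (k + 1))) 1, c.W)) :
    ∃ ν : FramedSphereFamily (𝓡∂ (n + 1 + 1)) c.W Unit k (l + 1), ν.sphereMap.Homotopic f := by
  obtain ⟨g, hfg⟩ := c.exists_homotopic_val_comp f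
  obtain ⟨e, he, himm, hinj, hec, heg⟩ := hE g
  obtain ⟨ν, hν⟩ := c.exists_framedSphereFamily_of_interior_immersion hdim hkl h he himm hinj
  refine ⟨ν, ?_⟩
  have h1 : ν.sphereMap =
      (⟨InteriorManifold.val, InteriorManifold.continuous_val⟩ : C(_, c.W)).comp ⟨e, hec⟩ := by
    ext u
    exact hν u
  rw [h1]
  exact ((ContinuousMap.Homotopic.refl _).comp heg).trans hfg.symm

end NullCobordism

end Literature.Topology.FourManifolds

end
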